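import Summits.AtomisticToContinuum.HydrodynamicLimit.Theses.WarmColdDichotomy
import Summits.AtomisticToContinuum.HydrodynamicLimit.Theses.OneFlightGossipEngine
import Summits.AtomisticToContinuum.HydrodynamicLimit.Theorems.OneFlightGossipEngineEnergyCurrentTailsPedigreeDocking
import Summits.AtomisticToContinuum.HydrodynamicLimit.Theorems.OneFlightGossipEngineEnergyCurrentTailsPedigreeLedgerSure
import Summits.AtomisticToContinuum.HydrodynamicLimit.Theorems.OneFlightGossipEngineEnergyCurrentTailsPedigreeMeasurable
import Summits.AtomisticToContinuum.HydrodynamicLimit.Theorems.OneFlightGossipEngineEnergyCurrentTailsPedigreeLevelInclusion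
import Summits.AtomisticToContinuum.HydrodynamicLimit.Theorems.OneFlightGossipEngineEnergyCurrentTailsPedigreeDataTails
import Summits.AtomisticToContinuum.HydrodynamicLimit.Theorems.OneFlightGossipEngineEnergyCurrentTailsPedigreeAssembly
import Summits.AtomisticToContinuum.HydrodynamicLimit.Theorems.OneFlightGossipEngineEnergyCurrentTailsPedigreeMergeIntake
import HarnessLib

/-!
# The certified reduction of the line `pedigree-perpetuity` (crux `EnergyCurrentTails`, stmt-AtomisticToContinuum-9235)

Lead seat c3 (`prover-line-stmt-AtomisticToContinuum-9235-c3-0`), cycle 1.  Every provable obligation of the line has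
LANDED (vocabulary p119207, kinematics p119223, docking p119348, `stub_lineageLedgerSure` p121734 (+ p120621),
`stub_lineageMeasurable` p120065, `stub_levelInclusion` p120048, `stub_initialEnergyTails` p120025,
`stub_censusAssembly` p120938 (+ p120359/p120360/p120361)), so the skeleton's composition collapses to the
CONDITIONAL DOCK of this file: the two crux-strength stubs of the line imply the crux BY NAME,

  `energyCurrentTails_of_pedigreePrices : NeutralRunTails → MergeIntakeTails → WarmColdDichotomy.EnergyCurrentTails`

(registered helper; `…_oneFlight` for the byte-identical `OneFlightGossipEngine` copy).  Any future producer of the two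
annealed lineage statistics `NeutralRunTails` (geometric tails of the energetic prefix of δ-neutral blocks of the
backward energy lineage) and `MergeIntakeTails` (summable tails of the discounted warm intake) closes the crux through
this theorem verbatim.

STRUCTURAL NOTE (finding of the cycle, see `mergeIntakeTails_of_gaussianCensusBound`, p120747): the discounted warm
intake is surely dominated by the present energy, `Λ ≤ ‖vᵢ(s)‖²` off a null event, so `MergeIntakeTails` is
CENSUS-STRENGTH — it follows from (and, at exponent 4 and modulo `NeutralRunTails` + data + ledger, is equivalent to)
an `N`-uniform one-time one-particle velocity tail; in particular it follows from the sibling line's transfer statement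
`GaussianCensusBound`, whence the second dock of this file,
`energyCurrentTails_of_neutralRuns_levelCensusStubs : NeutralRunTails → RateCeiling → MergeCeiling → SplitFloor →
WarmColdDichotomy.EnergyCurrentTails` — recorded only to make the dependence explicit (the level-census stubs alone
already imply the crux through `…EnergyCurrentTailsLevelCensus.energyCurrentTails_of_contactChaos`, p116061).
-/

namespace Summit.AtomisticToContinuum.HydrodynamicLimit.Theorems.EnergyCurrentTailsPedigree

/-- **The line's certified reduction** (registered helper `energyCurrentTails_of_pedigreePrices`): the two
crux-strength annealed lineage statistics imply the crux `WarmColdDichotomy.EnergyCurrentTails` BY NAME — docking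
(`stub_censusDocking`) ∘ census assembly (`stub_censusAssembly`) fed with the landed ledger
(`lineageLedger_of stub_lineageLedgerSure stub_lineageMeasurable`), the landed level inclusion
(`stub_levelInclusion stub_lineageLedgerSure`) and the landed data facts (`stub_initialEnergyTails`). -/
theorem energyCurrentTails_of_pedigreePrices : NeutralRunTails → MergeIntakeTails →
    Summit.AtomisticToContinuum.HydrodynamicLimit.Theses.WarmColdDichotomy.EnergyCurrentTails :=
  fun hR hM => stub_censusDocking
    (stub_censusAssembly (lineageLedger_of stub_lineageLedgerSure stub_lineageMeasurable)
      (stub_levelInclusion stub_lineageLedgerSure) stub_initialEnergyTails hR hM)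

/-- The same reduction, concluding the `OneFlightGossipEngine` copy of the crux (payload route of the line). -/
theorem energyCurrentTails_of_pedigreePrices_oneFlight : NeutralRunTails → MergeIntakeTails →
    Summit.AtomisticToContinuum.HydrodynamicLimit.Theses.OneFlightGossipEngine.EnergyCurrentTails :=
  fun hR hM => censusDocking_oneFlight
    (stub_censusAssembly (lineageLedger_of stub_lineageLedgerSure stub_lineageMeasurable)
      (stub_levelInclusion stub_lineageLedgerSure) stub_initialEnergyTails hR hM)

/-- **`CensusDecay` from neutral runs and a Gaussian census** (the merge channel docked on the sibling line's transfer
statement through the landed `mergeIntakeTails_of_gaussianCensusBound`). -/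
theorem censusDecay_of_neutralRuns_gaussianCensus : NeutralRunTails →
    Summit.AtomisticToContinuum.HydrodynamicLimit.Theorems.EnergyCurrentTailsLevelCensus.GaussianCensusBound →
      CensusDecay :=
  fun hR hG => stub_censusAssembly (lineageLedger_of stub_lineageLedgerSure stub_lineageMeasurable)
    (stub_levelInclusion stub_lineageLedgerSure) stub_initialEnergyTails hR
    (mergeIntakeTails_of_gaussianCensusBound stub_lineageLedgerSure hG)

/-- The dependence made explicit: neutral runs plus the three open dynamical stubs of the sibling line
`level-census-comparison` (which feed `GaussianCensusBound` through its landed ledger and closure) imply the crux. -/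
theorem energyCurrentTails_of_neutralRuns_levelCensusStubs : NeutralRunTails →
    Summit.AtomisticToContinuum.HydrodynamicLimit.Theorems.EnergyCurrentTailsLevelCensus.RateCeiling →
    Summit.AtomisticToContinuum.HydrodynamicLimit.Theorems.EnergyCurrentTailsLevelCensus.MergeCeiling →
    Summit.AtomisticToContinuum.HydrodynamicLimit.Theorems.EnergyCurrentTailsLevelCensus.SplitFloor →
      Summit.AtomisticToContinuum.HydrodynamicLimit.Theses.WarmColdDichotomy.EnergyCurrentTails :=
  fun hR h₁ h₂ h₃ => energyCurrentTails_of_pedigreePrices hR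
    (mergeIntakeTails_of_levelCensusStubs stub_lineageLedgerSure h₁ h₂ h₃)

end Summit.AtomisticToContinuum.HydrodynamicLimit.Theorems.EnergyCurrentTailsPedigree
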